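import Summits.BirchSwinnertonDyer.BirchSwinnertonDyer.Theorems.GenusKolyvaginAtTwoGenusPrimitiveSupplyAtTwoTranspositionTwistLaw
import Summits.BirchSwinnertonDyer.BirchSwinnertonDyer.Theorems.GenusKolyvaginAtTwoGenusPrimitiveSupplyAtTwoTranspositionSupply
import HarnessLib

/-!
# Route `GenusKolyvaginAtTwo`, crux #2 `GenusPrimitiveSupplyAtTwo` (stmt-BirchSwinnertonDyer-22136):
# EVERY `Δ < 0` RANK-ONE CURVE WITH `E(ℚ)[2] = 0`, `Ш[2] = 0` HAS A PRIME HEEGNER TWIST WITH TRIVIAL `2`-SELMER GROUP —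
# T-q₀ (law) ∘ AN-24S (supply), both now tree theorems

Width seat `bsd-line-gk2-p4` g13 (cell `bsd-f1-sign2`), sequel of `…TranspositionTwistLaw` (`transpositionTwistLawAtTwo_holds`, T-q₀ BY NAME) and
`…TranspositionSupply` (`transpositionSupplyAtTwo_holds`, AN-24S BY NAME). THEOREMS ONLY (no definition, no named fact, no `sorry`); helper
`--supports stmt-BirchSwinnertonDyer-22136`; no item is closed; BSD is not proved by any of this.

WHAT. **`exists_transpAdmissible_door_twistSelmerTwoCard_eq_one`**: for `W/ℚ` globally minimal elliptic with `Δ_W < 0`, `E(ℚ)[2] = 0`, Mordell–Weil rank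
`1` and `Ш(W)[2] = 0` there are an imaginary quadratic `K` (`= ℚ(√−ℓ)`, `ℓ` a Mazur–Rubin twisting prime), Heegner for `N_W` with `(d_K, N_W) = 1`, and a
prime `q₀ = ℓ` with `(d_K, q₀)` transposition-admissible, the door OPEN at `q₀`, and **`#Sel₂(W^{(d_K)}) = 1`** — so the twist `E^{(−ℓ)}` has
Mordell–Weil rank `0` and `Ш(E^{(−ℓ)})[2] = 0`, unconditionally (the `Δ < 0` counterpart of the lineage's `Sel₂`-minimal prime Heegner twins).
`twistSelmerTwoCard_eq_one_or_four_of_transpAdmissible` records the dichotomy for EVERY transposition-admissible `(d, q₀)` on that locus.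

References: [MazurRubin2010] Prop. 3.3, Cor. 3.4 (i), Lemma 3.5; [Kramer1981] Prop. 3; [GrossLMS1991] §9.
-/

set_option linter.dupNamespace false -- tree convention: `Summit.BirchSwinnertonDyer.BirchSwinnertonDyer.Theorems` (summit = sub-problem)
set_option autoImplicit false

noncomputable section

open scoped Classical

namespace Summit.BirchSwinnertonDyer.BirchSwinnertonDyer.Theorems.GenusKolyTransp

open WeierstrassCurve NumberField
open Literature.NumberTheory.EllipticCurves
open Summit.BirchSwinnertonDyer.Rank1Residual.F1Sign2
open Summit.BirchSwinnertonDyer.Rank1Residual.F1Sign2.TranspositionDoor (TranspAdmissible MeetsNonNormAt)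

variable (W : WeierstrassCurve ℚ) [W.IsElliptic] [W.IsGloballyMinimal]

/-- **The dichotomy for every transposition-admissible twist** on `{Δ < 0, E(ℚ)[2] = 0, rank 1, Ш[2] = 0}`: `#Sel₂(W^{(d)}) = 1` or `= 4`, according as
the door at `q₀` is open or shut (T-q₀, `transpositionTwistLawAtTwo_holds`). [cite: MazurRubin2010, Cor. 3.4 (i)] [cite: Kramer1981, Prop. 3] -/
theorem twistSelmerTwoCard_eq_one_or_four_of_transpAdmissible (hΔ : W.Δ < 0) (hT : NoRationalTwoTorsion W) (hrank : W.mordellWeilRank = 1)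
    (hSha : ShaTwoTrivial W) {d : ℤ} {q₀ : ℕ} [Fact q₀.Prime] (hadm : TranspAdmissible W d q₀) :
    (MeetsNonNormAt W q₀ ∧ twistSelmerTwoCard W d = 1) ∨ (¬ MeetsNonNormAt W q₀ ∧ twistSelmerTwoCard W d = 4) := by
  obtain ⟨hopen, hshut⟩ := transpositionTwistLawAtTwo_holds W hΔ hT hrank hSha d q₀ hadm
  by_cases h : MeetsNonNormAt W q₀
  · exact Or.inl ⟨h, hopen h⟩
  · exact Or.inr ⟨h, hshut h⟩

/-- **Every `Δ < 0` rank-one curve with `E(ℚ)[2] = 0` and `Ш(W)[2] = 0` has an admissible prime Heegner twist with TRIVIAL `2`-Selmer group**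
(`#Sel₂(W^{(d_K)}) = 1`, door open at `q₀`, `(d_K, N_W) = 1`, Heegner hypothesis): AN-24S (`transpositionSupplyAtTwo_holds`: the LEAD's Mazur–Rubin
twisting prime read through the Kummer dictionary) composed with T-q₀ (`transpositionTwistLawAtTwo_holds`). Unconditional.
[cite: MazurRubin2010, Prop. 3.3, Cor. 3.4 (i) and Lemma 3.5] [cite: Kramer1981, Prop. 3] [cite: GrossLMS1991, §9 Prop. 9.6] -/
theorem exists_transpAdmissible_door_twistSelmerTwoCard_eq_one [NeZero (W.conductorNorm ℤ)] (hΔ : W.Δ < 0) (hT : NoRationalTwoTorsion W)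
    (hrank : W.mordellWeilRank = 1) (hSha : ShaTwoTrivial W) :
    ∃ (K : Type) (_ : Field K) (_ : NumberField K) (q₀ : ℕ) (_ : Fact q₀.Prime),
      IsImaginaryQuadratic K ∧ TranspAdmissible W (NumberField.discr K) q₀ ∧ MeetsNonNormAt W q₀ ∧
      Nat.Coprime (NumberField.discr K).natAbs (W.conductorNorm ℤ) ∧ SatisfiesHeegnerHypothesis (W.conductorNorm ℤ) K ∧
      twistSelmerTwoCard W (NumberField.discr K) = 1 := by
  obtain ⟨K, _, _, q₀, _, hK, hadm, hdoor, hcop, hH⟩ := transpositionSupplyAtTwo_holds W hΔ hT hrank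
  exact ⟨K, inferInstance, inferInstance, q₀, inferInstance, hK, hadm, hdoor, hcop, hH,
    (transpositionTwistLawAtTwo_holds W hΔ hT hrank hSha (NumberField.discr K) q₀ hadm).1 hdoor⟩

end Summit.BirchSwinnertonDyer.BirchSwinnertonDyer.Theorems.GenusKolyTransp

end
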